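import Literature.NumberTheory.ConnesConsani.AdeleClassTraceFormula
import Mathlib.Analysis.Normed.Ring.InfiniteSum
import Mathlib.Topology.Algebra.InfiniteSum.NatInt
import HarnessLib

/-!
# Connes 1999 Thm VII.4, `k = ℚ`, `S = {∞} ∪ P` — RESUMMATION OF THE ANNULUS SERIES INTO THE LOCAL TERM:
# `(1 − r²) Σ_{a,b ≥ 0} r^{a+b} G(a − b) = G(0) + Σ_{m ≥ 1} r^m (G(m) + G(−m))` and its instance
# `r = p^{−1/2}`, `G(m) = log p · g(m log p)` giving `log p · g(0) + ∫′_{ℚ_p^*} = log p · g(0) + connesLocalTerm p g`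

LABEL (line 1): RH-FREE literature (theorems + one auxiliary `def`, a reindexing bijection `ℕ × ℤ ≃ ℕ × ℕ`;
NO named fact).  bears_on: LADDER-RH W-C/W-P (C1 named-fact debt), cell `rh-crit`, sub-cell cc, overflow row O1
— green layer under the row's last named fact `Connes1999_thm_VII_4_rat` (the cases `P ≠ ∅`), seventh file of
the "annulus road".  WHAT THIS IS NOT: any claim about positivity, Weil's criterion or RH — an identity of
absolutely convergent double series; nothing here bears on the truth of RH.

Sources.  A. Connes, Selecta Math. 5 (1999) [`Connes1999`], §VII proof of Thm 4, eqs. (30)–(33): the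
`p`-adic contribution `∫′_{ℚ_p^*} h(u⁻¹)|u|^{1/2} d^*u = log p · Σ_{k ≠ 0} p^{−|k|/2} g(k log p)` arises by
summing the geometric series of the annulus pieces (held text `paper:arxiv-math_9811068`, p0013); the local
term is the tree's `connesLocalTerm` [`ConnesConsani/AdeleClassTraceFormula`].

## What is proved

* `minDiffEquiv : ℕ × ℤ ≃ ℕ × ℕ`, `(k, m) ↦ (k + m⁺, k + m⁻)` (inverse `(a, b) ↦ (min a b, a − b)`; on the
  diagonal `m`: `a + b = 2k + |m|`, `a − b = m` — private plumbing);
* **`hasSum_geometric_pair_smul`** — for a real Banach space `E`, `0 ≤ r < 1` and a bounded `G : ℤ → E`: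
  `Σ_{(a,b) ∈ ℕ²} ((1 − r²) r^{a+b}) • G(a − b) = G 0 + Σ_{n ≥ 0} r^{n+1} • (G(n+1) + G(−(n+1)))`
  (absolutely convergent; regroup along the diagonals `a − b = m`, `Σ_k (1 − r²) r^{2k} = 1`);
* **`hasSum_annulus_pair_connesLocalTerm`** — the instance `r = p^{−1/2}`, `G(m) = log p · g(m log p)` for a
  bounded `g`: `Σ_{(a,b)} ((1 − p⁻¹) p^{−(a+b)/2}) • (log p · g((a − b) log p)) = log p · g(0) + connesLocalTerm p g`.
  In the annulus road (`AnnulusCorrectionExpansion`: `u_p^* P_Λ u_p − P_Λ = (1 − p⁻¹) Σ_{a,b} (1−θ_p)^a Q₀ D_p^b·… − Q₀`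
  with `(1−θ_p)^a Q₀ D_p^b = p^{−(a+b)/2} ϑ(p^a) Q₀ ϑ(p^{−b})` and `Tr(ϑ(g) ϑ(p^a) Q₀(1) ϑ(p^{−b}))|_ev = log p · g((a−b) log p)`)
  this is the final bookkeeping step producing `Σ_{p} connesLocalTerm p g`.

No instance, notation or attribute.
-/

noncomputable section

open Filter
open scoped Topology

namespace Literature.NumberTheory.Connes2026

open Literature.NumberTheory.ConnesConsani

/-! ## §1. Reindexing `ℕ × ℕ` by (minimum, difference) -/

/-- The bijection `(k, m) ↦ (k + m⁺, k + m⁻) : ℕ × ℤ ≃ ℕ × ℕ`, inverse `(a, b) ↦ (min a b, a − b)` — the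
diagonals `a − b = m` of `ℕ²`. [folklore] -/
def minDiffEquiv : ℕ × ℤ ≃ ℕ × ℕ where
  toFun km := (km.1 + km.2.toNat, km.1 + (-km.2).toNat)
  invFun ab := (min ab.1 ab.2, (ab.1 : ℤ) - ab.2)
  left_inv := by
    rintro ⟨k, m⟩
    ext <;> simp only <;> omega
  right_inv := by
    rintro ⟨a, b⟩
    ext <;> simp only <;> omega

/-- Unfolding `minDiffEquiv`. [folklore] -/
private theorem minDiffEquiv_apply (k : ℕ) (m : ℤ) : minDiffEquiv (k, m) = (k + m.toNat, k + (-m).toNat) := rfl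

/-- On the diagonal `m`: `a + b = 2k + |m|`. [folklore] -/
private theorem minDiffEquiv_sum (k : ℕ) (m : ℤ) :
    (minDiffEquiv (k, m)).1 + (minDiffEquiv (k, m)).2 = 2 * k + m.natAbs := by
  rw [minDiffEquiv_apply]
  simp only
  omega

/-- On the diagonal `m`: `a − b = m`. [folklore] -/
private theorem minDiffEquiv_sub (k : ℕ) (m : ℤ) :
    ((minDiffEquiv (k, m)).1 : ℤ) - (minDiffEquiv (k, m)).2 = m := by
  rw [minDiffEquiv_apply]
  simp only
  omega

/-! ## §2. The resummation identity -/

section Resummation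

variable {E : Type*} [NormedAddCommGroup E] [NormedSpace ℝ E] [CompleteSpace E]

/-- Absolute convergence of `Σ_{(a,b)} ((1 − r²) r^{a+b}) • G(a − b)` for bounded `G`, `0 ≤ r < 1`. [cite: Connes1999, §VII proof of Thm 4 eqs. (30)–(33) (arXiv p0013)] -/
theorem summable_geometric_pair_smul {r : ℝ} (hr0 : 0 ≤ r) (hr1 : r < 1) (G : ℤ → E) {C : ℝ}
    (hG : ∀ m, ‖G m‖ ≤ C) :
    Summable fun ab : ℕ × ℕ => ((1 - r ^ 2) * r ^ (ab.1 + ab.2)) • G ((ab.1 : ℤ) - ab.2) := by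
  have hr2 : 0 ≤ 1 - r ^ 2 := by nlinarith
  have hgeo := summable_geometric_of_lt_one hr0 hr1
  have hprod : Summable fun ab : ℕ × ℕ => r ^ ab.1 * r ^ ab.2 :=
    hgeo.mul_of_nonneg hgeo (fun _ => pow_nonneg hr0 _) (fun _ => pow_nonneg hr0 _)
  refine Summable.of_norm_bounded ((hprod.mul_left ((1 - r ^ 2) * C))) fun ab => ?_
  rw [norm_smul, Real.norm_eq_abs, abs_of_nonneg (mul_nonneg hr2 (pow_nonneg hr0 _)), pow_add]
  calc (1 - r ^ 2) * (r ^ ab.1 * r ^ ab.2) * ‖G ((ab.1 : ℤ) - ab.2)‖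
      ≤ (1 - r ^ 2) * (r ^ ab.1 * r ^ ab.2) * C :=
        mul_le_mul_of_nonneg_left (hG _) (mul_nonneg hr2 (mul_nonneg (pow_nonneg hr0 _) (pow_nonneg hr0 _)))
    _ = (1 - r ^ 2) * C * (r ^ ab.1 * r ^ ab.2) := by ring

/-- The `ℤ`-indexed sum `Σ_m r^{|m|} • G m = G 0 + Σ_n r^{n+1} • (G(n+1) + G(−(n+1)))`. [cite: Connes1999, §VII proof of Thm 4 eqs. (30)–(33) (arXiv p0013)] -/
theorem hasSum_int_pow_natAbs_smul {r : ℝ} (hr0 : 0 ≤ r) (hr1 : r < 1) (G : ℤ → E) {C : ℝ}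
    (hG : ∀ m, ‖G m‖ ≤ C) :
    HasSum (fun m : ℤ => r ^ m.natAbs • G m)
      (G 0 + ∑' n : ℕ, r ^ (n + 1) • (G ((n + 1 : ℕ) : ℤ) + G (-((n + 1 : ℕ) : ℤ)))) := by
  have hgeo := summable_geometric_of_lt_one hr0 hr1
  -- the two tails are absolutely convergent
  have htail : ∀ (H : ℕ → E), (∀ n, ‖H n‖ ≤ C) → Summable fun n : ℕ => r ^ (n + 1) • H n := fun H hH => by
    refine Summable.of_norm_bounded (((summable_nat_add_iff 1).mpr hgeo).mul_right C) fun n => ?_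
    rw [norm_smul, Real.norm_eq_abs, abs_of_nonneg (pow_nonneg hr0 _)]
    exact mul_le_mul_of_nonneg_left (hH n) (pow_nonneg hr0 _)
  have hpos : Summable fun n : ℕ => r ^ (n + 1) • G ((n + 1 : ℕ) : ℤ) := htail _ fun n => hG _
  have hneg : Summable fun n : ℕ => r ^ (n + 1) • G (-((n + 1 : ℕ) : ℤ)) := htail _ fun n => hG _
  -- nonnegative indices: `Σ_{n ≥ 0} r^n • G n = G 0 + Σ_n r^{n+1} • G(n+1)`
  have h1 : HasSum (fun n : ℕ => r ^ (n : ℤ).natAbs • G n) (G 0 + ∑' n : ℕ, r ^ (n + 1) • G ((n + 1 : ℕ) : ℤ)) := by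
    have h := HasSum.zero_add (f := fun n : ℕ => r ^ n • G (n : ℤ)) (by
      simpa only using hpos.hasSum)
    simp only [pow_zero, one_smul, Nat.cast_zero] at h
    simpa only [Int.natAbs_natCast] using h
  -- negative indices
  have h2 : HasSum (fun n : ℕ => r ^ (-((n : ℤ) + 1)).natAbs • G (-((n : ℤ) + 1)))
      (∑' n : ℕ, r ^ (n + 1) • G (-((n + 1 : ℕ) : ℤ))) := by
    have h := hneg.hasSum
    refine h.congr_fun fun n => ?_
    have h3 : (-((n : ℤ) + 1)).natAbs = n + 1 := by omega
    have h4 : (-((n + 1 : ℕ) : ℤ)) = -((n : ℤ) + 1) := by push_cast; ring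
    rw [h3, h4]
  have h12 := HasSum.of_nat_of_neg_add_one (f := fun m : ℤ => r ^ m.natAbs • G m) h1 h2
  rw [add_assoc, ← hpos.tsum_add hneg] at h12
  simpa only [smul_add] using h12

/-- **Resummation along the diagonals**: for a real Banach space `E`, `0 ≤ r < 1`, and a bounded `G : ℤ → E`,
`Σ_{(a,b) ∈ ℕ²} ((1 − r²) r^{a+b}) • G(a − b) = G(0) + Σ_{n ≥ 0} r^{n+1} • (G(n+1) + G(−(n+1)))`
(on the diagonal `a − b = m` one has `a + b = 2 min(a,b) + |m|` and `(1 − r²) Σ_k r^{2k} = 1`). [cite: Connes1999, §VII proof of Thm 4 eqs. (30)–(33) (arXiv p0013)] -/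
theorem hasSum_geometric_pair_smul {r : ℝ} (hr0 : 0 ≤ r) (hr1 : r < 1) (G : ℤ → E) {C : ℝ}
    (hG : ∀ m, ‖G m‖ ≤ C) :
    HasSum (fun ab : ℕ × ℕ => ((1 - r ^ 2) * r ^ (ab.1 + ab.2)) • G ((ab.1 : ℤ) - ab.2))
      (G 0 + ∑' n : ℕ, r ^ (n + 1) • (G ((n + 1 : ℕ) : ℤ) + G (-((n + 1 : ℕ) : ℤ)))) := by
  have hsum := summable_geometric_pair_smul hr0 hr1 G hG
  set S := ∑' ab : ℕ × ℕ, ((1 - r ^ 2) * r ^ (ab.1 + ab.2)) • G ((ab.1 : ℤ) - ab.2) with hS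
  have hF : HasSum (fun ab : ℕ × ℕ => ((1 - r ^ 2) * r ^ (ab.1 + ab.2)) • G ((ab.1 : ℤ) - ab.2)) S :=
    hsum.hasSum
  -- transport to `ℕ × ℤ` and swap to `ℤ × ℕ`
  have hF' : HasSum (fun km : ℕ × ℤ => ((1 - r ^ 2) * r ^ (2 * km.1 + km.2.natAbs)) • G km.2) S := by
    have h := (minDiffEquiv.hasSum_iff (f := fun ab : ℕ × ℕ =>
      ((1 - r ^ 2) * r ^ (ab.1 + ab.2)) • G ((ab.1 : ℤ) - ab.2))).mpr hF
    refine h.congr_fun fun km => ?_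
    obtain ⟨k, m⟩ := km
    simp only [Function.comp_apply]
    rw [minDiffEquiv_sum, minDiffEquiv_sub]
  have hF'' : HasSum (fun mk : ℤ × ℕ => ((1 - r ^ 2) * r ^ (2 * mk.2 + mk.1.natAbs)) • G mk.1) S :=
    (Equiv.prodComm ℤ ℕ).hasSum_iff.mpr hF'
  -- sum each diagonal: `Σ_k (1 − r²) r^{2k + |m|} = r^{|m|}`
  have hr2lt : r ^ 2 < 1 := by nlinarith
  have hdiag : ∀ m : ℤ, HasSum (fun k : ℕ => ((1 - r ^ 2) * r ^ (2 * k + m.natAbs)) • G m)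
      (r ^ m.natAbs • G m) := fun m => by
    have hg := (hasSum_geometric_of_lt_one (sq_nonneg r) hr2lt).mul_left ((1 - r ^ 2) * r ^ m.natAbs)
    have hne : (1 - r ^ 2) ≠ 0 := by nlinarith
    rw [mul_right_comm, mul_inv_cancel₀ hne, one_mul] at hg
    refine (hg.smul_const (G m)).congr_fun fun k => ?_
    rw [pow_add, pow_mul]
    congr 1
    ring
  have hZ : HasSum (fun m : ℤ => r ^ m.natAbs • G m) S := hF''.prod_fiberwise hdiag
  rwa [hZ.unique (hasSum_int_pow_natAbs_smul hr0 hr1 G hG)] at hF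

end Resummation

/-! ## §3. The instance `r = p^{−1/2}`: the local term `connesLocalTerm p g` -/

section LocalTerm

/-- `((√p)⁻¹)^n = p^{−n/2}` (the weights of `connesLocalTerm`). [cite: Connes1999, §VII Thm 4 (arXiv p0013)] -/
theorem inv_sqrt_pow_eq_rpow {p : ℕ} (hp : 0 < p) (n : ℕ) :
    ((Real.sqrt p)⁻¹) ^ n = (p : ℝ) ^ (-(n : ℝ) / 2) := by
  have hp0 : (0 : ℝ) < p := by exact_mod_cast hp
  rw [Real.sqrt_eq_rpow, ← Real.rpow_neg hp0.le, ← Real.rpow_natCast, ← Real.rpow_mul hp0.le]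
  congr 1
  ring

/-- **The annulus double series sums to `log p · g(0) + connesLocalTerm p g`**: for a bounded `g : ℝ → ℂ` and a
prime (indeed any `p ≥ 2`),
`Σ_{(a,b) ∈ ℕ²} ((1 − p⁻¹) p^{−(a+b)/2}) • (log p · g((a − b) log p)) = log p · g(0) + connesLocalTerm p g`,
`connesLocalTerm p g = Σ_{m ≥ 1} log p · p^{−m/2} (g(m log p) + g(−m log p))` being Connes' `∫′_{ℚ_p^*} h(u⁻¹)|u|^{1/2} d^*u`. [cite: Connes1999, §VII Thm 4 and proof eqs. (30)–(33) (arXiv p0013)] -/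
theorem hasSum_annulus_pair_connesLocalTerm {p : ℕ} (hp : 2 ≤ p) (g : ℝ → ℂ) {C : ℝ} (hg : ∀ x, ‖g x‖ ≤ C) :
    HasSum (fun ab : ℕ × ℕ =>
        ((1 - (p : ℝ)⁻¹) * ((Real.sqrt p)⁻¹) ^ (ab.1 + ab.2)) •
          ((Real.log p : ℂ) * g ((((ab.1 : ℤ) - ab.2 : ℤ) : ℝ) * Real.log p)))
      ((Real.log p : ℂ) * g 0 + connesLocalTerm p g) := by
  have hp0 : (0 : ℝ) < p := by exact_mod_cast (by omega : 0 < p)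
  have hr0 : 0 ≤ (Real.sqrt p)⁻¹ := inv_nonneg.mpr (Real.sqrt_nonneg _)
  have hr1 : (Real.sqrt p)⁻¹ < 1 := by
    rw [inv_lt_one_iff₀]
    right
    rw [show (1 : ℝ) = Real.sqrt 1 by simp]
    exact Real.sqrt_lt_sqrt zero_le_one (by exact_mod_cast (by omega : 1 < p))
  have hr2 : ((Real.sqrt p)⁻¹) ^ 2 = (p : ℝ)⁻¹ := by
    rw [inv_pow, Real.sq_sqrt hp0.le]
  -- the bounded diagonal function
  set G : ℤ → ℂ := fun m => (Real.log p : ℂ) * g ((m : ℝ) * Real.log p) with hGdef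
  have hG : ∀ m, ‖G m‖ ≤ ‖(Real.log p : ℂ)‖ * C := fun m => by
    rw [hGdef, norm_mul]
    exact mul_le_mul_of_nonneg_left (hg _) (norm_nonneg _)
  have h := hasSum_geometric_pair_smul (E := ℂ) hr0 hr1 G hG
  rw [hr2] at h
  have hG0 : G 0 = (Real.log p : ℂ) * g 0 := by simp [hGdef]
  -- identify the tail with `connesLocalTerm p g`
  have htail : (∑' n : ℕ, ((Real.sqrt p)⁻¹) ^ (n + 1) • (G ((n + 1 : ℕ) : ℤ) + G (-((n + 1 : ℕ) : ℤ)))) =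
      connesLocalTerm p g := by
    unfold connesLocalTerm
    refine tsum_congr fun n => ?_
    rw [hGdef]
    simp only
    rw [inv_sqrt_pow_eq_rpow (by omega : 0 < p) (n + 1), Complex.real_smul]
    push_cast
    ring
  rw [hG0, htail] at h
  exact h

end LocalTerm

end Literature.NumberTheory.Connes2026
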